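import Summits.QuantumFields.BalabanUV.Beta.GAN24.KFibClosedForm
import Summits.QuantumFields.BalabanUV.Beta.GAN24.AliasFibreBridge

/-!
# `BalabanUV.Beta.GAN24.KFibClosedBridge` — binder row G-an2-4 / (CONV-C), road P1-fibre, leaf **P1-L05b** (bridge) and input of **P1-L09**:
# `CombesThomasFibreStep.kFib = AliasObjects.kFibClosed` on the punctured real Brillouin zone

NOT IN PRINT; OUR PROOF ATTEMPT.  HONEST FRAMING (cell contract, verbatim): «discharging `BetaPertH` makes Bałaban's UV stability UNCONDITIONAL — a real
constructive-QFT result; it is NOT the continuum limit and NOT the Clay problem.»  HONEST DEPENDENCY (verbatim): «continuum YM on T⁴ ⇐ BetaPertH ∧ nine spine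
estimates (0/9 proved); BetaPertH ⇐ (D1) ∧ (D4) ∧ CAP+tail; G-an2-4 gates asym, D1 and NE2/3/4.»  [folklore] finite sums / linear algebra over `ℂ`: an
IDENTIFICATION (no estimate, no cited fact, no wall binder, no `def … : Prop` fact).  NOT summit progress; nothing of (CONV-C)'s K-slot is discharged here.

## What is proved (generic `d`; `N ≥ 1`, `M`, units `s_f, s_m`; REAL quasi-momentum `p = ofRealVec q` with `q ∈ BZ (d+1)`, `q ≠ 0`)
§1 WEIGHT DICTIONARY (my leg sums ↦ T00's products of geometric sums): `sum_LegIdx_pw` (`Σ_{(r,s) ∈ LegIdx d M} pw k (M•x′ + r + s e_κ) = pw k (M•x′)·(Π_i gs (k i) M)·gs (k κ) M`),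
   `legCoef_inl_mul_readW` (`C_f · KFibLegSource.readW = s_f · AliasObjects.readW`), `fieldLegSrc_eq_smul_fhatF` (`KFibLegSource.fieldLegSrc … C_f l y′ = s_f • AliasObjects.fhatF … l y′`),
   `legSrcVec_inr_Q_eq_smul_eVec` (the multiplier Q-source is `(s_m·cphase(−quo N (M•y′)) p) • eVec l`).
§2 LINEARITY of T00's closed forms in the sources: `srcPhi_smul`, `srcC_smul`, `capSol_smul`, `phiSol_smul`, `cSol_smul`, `gAl_smul`, `Ahat_smul`
   (`Ahat N p (c • f̂) (c • ĉ) m = c • Ahat N p f̂ ĉ m`, any complex `p`, any scalar `c`).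
§3 **THE BRIDGE**: `kFibW_eq_kFibClosedW` / **`kFib_eq_kFibClosed`** — for `q ∈ BZ ∖ {0}`, every `N ≥ 1`, `M`, `s_f`, `s_m` and all four leg types,
   `kFibW N M s_f s_m a x′ b y′ (ofRealVec q) = AliasObjects.kFibClosedW N M s_f s_m a x′ b y′ (ofRealVec q)` and
   `kFib Lc s_f s_m j a x′ b y′ (ofRealVec q) = AliasObjects.kFibClosed Lc s_f s_m j a x′ b y′ (ofRealVec q)`
   (my `KFibClosedForm.kFibW_eq_readout`/`readout_inl` + leaf-06's `AliasFibreBridge.boxData_eq_synth_Ahat`/`phi_eq_phiSol` on the leg source vector + §1 + §2).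
   So every estimate of rows Y09*/Y11* on `kFibClosedW`/`kFibClosed` IS an estimate of the wall's fibre function `kFib` (rows L09/L11), on `BZ ∖ {0}`; the point
   `q = 0` is supplied by continuity (`GAN24/FibreContinuity`, row Y09c).
Unit `b2b-balaban-gan24-formalise-leaf-05` (G-an2-4 formalisation swarm), 2026-08-20.
-/

noncomputable section

open Complex Finset
open scoped BigOperators Matrix
open Literature.MathematicalPhysics.QuantumFieldTheory
open Literature.MathematicalPhysics.QuantumFieldTheory.Balaban1983to89
open Literature.MathematicalPhysics.QuantumFieldTheory.Balaban1983to89.Beta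
open Literature.MathematicalPhysics.QuantumFieldTheory.LatticeForm (repZ quo)
open Literature.Probability.LatticeModels (TorusSite Torus.proj)
open B4Strip (ofRealVec)
open B4ContourShift (BZ)
open AffineAveraging (Site unitVec)
open BlochFibreMatrix (Idx blochChar blochChar_apply fibreFun fibreMatrix)
open FibreInverseDecay (cphase)
open OneStepResolventKernel (Fib)
open OneStepKernelFamily (LegIdx legSet legPt legW)
open Summit.QuantumFields.BalabanUV.Beta.HessKerDressedUnits (legScale)
open Summit.QuantumFields.BalabanUV.Beta.GAN24.FibreSymbols (pw lapSym pw_add_unitVec)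
open Summit.QuantumFields.BalabanUV.Beta.GAN24.FibreBlockSolve (dot Asol)
open Summit.QuantumFields.BalabanUV.Beta.GAN24.FibreDFT (kFine)
open Summit.QuantumFields.BalabanUV.Beta.GAN24.FibreArrow (srcEL srcG)
open Summit.QuantumFields.BalabanUV.Beta.GAN24.CombesThomasFibreStep (kFibW kFib cphase_add_eq_mul)
open Summit.QuantumFields.BalabanUV.Beta.GAN24.AliasObjects
  (kAl gs sAl SAl sbAl SbAl chiAl dAl dbAl LAl sMAl SMAl sbMAl SbMAl piPerp reg cap srcPhi srcC capSol phiSol cSol gAl Ahat eVec fhatF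
   kFibClosedW kFibClosed)
open Summit.QuantumFields.BalabanUV.Beta.GAN24.AliasFibreBridge (pw_add_natMul_unitVec boxData_eq_synth_Ahat phi_eq_phiSol)
open Summit.QuantumFields.BalabanUV.Beta.GAN24.KFibLegSource
  (legSrcVec srcW readW fieldLegSrc fibreFun_invMulVec srcEL_legSrcVec_inl legSrcVec_inl_apply_inr legSrcVec_inl_Q srcEL_legSrcVec_inr
   legSrcVec_inr_apply legSrcVec_inr_Q)
open Summit.QuantumFields.BalabanUV.Beta.GAN24.KFibClosedForm (legCoef kFibW_eq_readout readout_inl)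

namespace Summit.QuantumFields.BalabanUV.Beta.GAN24.KFibClosedBridge

variable {d N : ℕ} [NeZero N]

/-! ## §1 The weight dictionary -/

/-- [folklore] `pw k (x + y) = pw k x · pw k y` for lattice points. -/
theorem pw_add_site (k : Fin (d + 1) → ℂ) (x y : Site (d + 1)) : pw k (x + y) = pw k x * pw k y := by
  unfold pw
  rw [← Complex.exp_add, ← mul_add, ← Finset.sum_add_distrib]
  congr 2
  exact Finset.sum_congr rfl fun μ _ => by simp only [Pi.add_apply, Int.cast_add]; ring

/-- [folklore] The plane wave at a point with natural coordinates is a product of exponentials. -/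
theorem pw_natVec (k : Fin (d + 1) → ℂ) (r : Fin (d + 1) → ℕ) : pw k (fun j => (r j : ℤ)) = ∏ i, cexp (I * k i * (r i : ℂ)) := by
  unfold pw
  rw [Finset.mul_sum, Complex.exp_sum]
  refine Finset.prod_congr rfl fun i _ => ?_
  simp only [Int.cast_natCast]
  ring_nf

/-- [folklore] A field leg point splits as `M•x′ + r + s•e_κ`. -/
theorem legPt_inl_eq (M : ℕ) (κ : Fin (d + 1)) (x' : Site (d + 1)) (i : (Fin (d + 1) → ℕ) × ℕ) :
    legPt M (Sum.inl κ : Fib d) x' i = ((M : ℤ) • x' + fun j => (i.1 j : ℤ)) + (i.2 : ℤ) • unitVec κ := by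
  funext j
  simp only [legPt, Pi.add_apply, Pi.smul_apply, smul_eq_mul, AffineAveraging.unitVec_apply]
  split_ifs <;> simp [add_assoc]

/-- [folklore] **BOX × CONTOUR SUM OF A PLANE WAVE** over the legs of a field leg based at `x′`:
`Σ_{(r,s) ∈ LegIdx d M} pw k (legPt M (inl κ) x′ (r,s)) = pw k (M•x′) · (Π_i gs (k i) M) · gs (k κ) M`. -/
theorem sum_LegIdx_pw (k : Fin (d + 1) → ℂ) (M : ℕ) (κ : Fin (d + 1)) (x' : Site (d + 1)) :
    ∑ i ∈ LegIdx d M, pw k (legPt M (Sum.inl κ : Fib d) x' i) = pw k ((M : ℤ) • x') * (∏ i, gs (k i) M) * gs (k κ) M := by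
  unfold LegIdx
  rw [Finset.sum_product]
  simp only [legPt_inl_eq, pw_add_site, pw_natVec]
  rw [← Finset.sum_mul_sum, ← Finset.mul_sum,
    ← Finset.prod_univ_sum (fun _ : Fin (d + 1) => Finset.range M) (fun i j => cexp (I * k i * (j : ℂ)))]
  have hs : ∑ j ∈ Finset.range M, pw k ((j : ℤ) • unitVec κ) = gs (k κ) M := by
    unfold gs
    refine Finset.sum_congr rfl fun s _ => ?_
    rw [← zero_add ((s : ℤ) • unitVec κ), pw_add_natMul_unitVec, FibreDFT.pw_zero_site, one_mul]
  rw [hs]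
  rfl

/-- [folklore] `pw k (M•x′) = exp(i Σ_i k_i·(M·x′_i))` — T00's offset phase. -/
theorem pw_zsmul_eq_cexp (k : Fin (d + 1) → ℂ) (M : ℕ) (x' : Site (d + 1)) :
    pw k ((M : ℤ) • x') = cexp (I * ∑ i, k i * ((M : ℂ) * (x' i : ℂ))) := by
  unfold pw
  congr 2
  exact Finset.sum_congr rfl fun i _ => by simp only [Pi.smul_apply, smul_eq_mul, Int.cast_mul, Int.cast_natCast]

/-- [folklore] `pw (−k) (M•y′) = exp(−i Σ_i k_i·(M·y′_i))`. -/
theorem pw_neg_zsmul_eq_cexp (k : Fin (d + 1) → ℂ) (M : ℕ) (y' : Site (d + 1)) :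
    pw (-k) ((M : ℤ) • y') = cexp (-(I * ∑ i, k i * ((M : ℂ) * (y' i : ℂ)))) := by
  rw [pw_zsmul_eq_cexp]
  congr 1
  rw [← mul_neg, ← Finset.sum_neg_distrib]
  congr 1
  exact Finset.sum_congr rfl fun i _ => by simp only [Pi.neg_apply]; ring

/-- [folklore] MY READING WEIGHT IS T00's, UP TO THE UNITS: `readW N M p κ x′ m = pw k_m (M•x′) · SMAl · sMAl κ`. -/
theorem readW_eq (M : ℕ) (p : Fin (d + 1) → ℂ) (κ : Fin (d + 1)) (x' : Site (d + 1)) (m : TorusSite (d + 1) N) :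
    readW N M p κ x' m = pw (kAl N p m) ((M : ℤ) • x') * SMAl N M p m * sMAl N M p m κ := by
  unfold readW
  rw [sum_LegIdx_pw]
  rfl

/-- [folklore] MY SOURCE WEIGHT IS T00's flat twin: `srcW N M p l y′ m = pw (−k_m) (M•y′) · SbMAl · sbMAl l`. -/
theorem srcW_eq (M : ℕ) (p : Fin (d + 1) → ℂ) (l : Fin (d + 1)) (y' : Site (d + 1)) (m : TorusSite (d + 1) N) :
    srcW N M p l y' m = pw (-kAl N p m) ((M : ℤ) • y') * SbMAl N M p m * sbMAl N M p m l := by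
  unfold srcW
  rw [sum_LegIdx_pw]
  rfl

/-- [folklore] **`C_f · readW(mine) = s_f · readW(T00)`.** -/
theorem legCoef_inl_mul_readW (M : ℕ) (sf sm : ℝ) (p : Fin (d + 1) → ℂ) (κ : Fin (d + 1)) (x' : Site (d + 1)) (m : TorusSite (d + 1) N) :
    legCoef M sf sm (Sum.inl κ : Fib d) * readW N M p κ x' m = (sf : ℂ) * AliasObjects.readW N M p m κ x' := by
  rw [readW_eq, pw_zsmul_eq_cexp]
  unfold legCoef AliasObjects.readW
  simp only [legScale, legW]
  push_cast
  rw [div_eq_mul_inv]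
  ring

/-- [folklore] **`fieldLegSrc(mine) … C_f l y′ = s_f • fhatF(T00) … l y′`.** -/
theorem fieldLegSrc_eq_smul_fhatF (M : ℕ) (sf sm : ℝ) (p : Fin (d + 1) → ℂ) (l : Fin (d + 1)) (y' : Site (d + 1)) :
    fieldLegSrc N M p (legCoef M sf sm (Sum.inl l : Fib d)) l y' = (sf : ℂ) • fhatF N M p l y' := by
  funext m κ'
  simp only [fieldLegSrc, fhatF, Pi.smul_apply, smul_eq_mul]
  by_cases h : κ' = l
  · rw [if_pos h, if_pos h, srcW_eq, pw_neg_zsmul_eq_cexp]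
    unfold legCoef AliasObjects.srcW
    simp only [legScale, legW]
    push_cast
    rw [div_eq_mul_inv, div_eq_mul_inv]
    ring
  · rw [if_neg h, if_neg h, mul_zero]

/-- [folklore] The multiplier Q-source is a scaled unit vector: `(C_m·cphase(−quo N (M•y′)) p) • eVec l`. -/
theorem legSrcVec_inr_Q_eq_smul_eVec (M : ℕ) (p : Fin (d + 1) → ℂ) (C : ℂ) (l : Fin (d + 1)) (y' : Site (d + 1)) :
    (fun κ => legSrcVec N M p C (Sum.inr l) y' (Sum.inr (Sum.inr κ))) = (C * cphase (-quo N ((M : ℤ) • y')) p) • eVec l := by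
  rw [legSrcVec_inr_Q]
  funext κ
  simp only [eVec, Pi.smul_apply, smul_eq_mul, mul_ite, mul_one, mul_zero]

/-! ## §2 Linearity of T00's closed forms in the sources -/

section Linear

variable {D : ℕ} (p : Fin D → ℂ) (c : ℂ) (fhat : TorusSite D N → Fin D → ℂ) (chat : Fin D → ℂ)

/-- [folklore] `dot u (c • v) = c · dot u v`. -/
theorem dot_smul_pi (u v : Fin D → ℂ) : dot u (c • v) = c * dot u v := by
  simp only [dot, Pi.smul_apply, smul_eq_mul, Finset.mul_sum]
  exact Finset.sum_congr rfl fun i _ => by ring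

/-- [folklore] `Π⊥` is linear. -/
theorem piPerp_smul (dd db : Fin D → ℂ) (L : ℂ) (f : Fin D → ℂ) : piPerp dd db L (c • f) = c • piPerp dd db L f := by
  funext κ
  simp only [piPerp, Pi.smul_apply, smul_eq_mul, dot_smul_pi]
  ring

/-- [folklore] `r_φ` is linear in `(f̂, ĉ)`. -/
theorem srcPhi_smul : srcPhi N p (c • fhat) (c • chat) = c • srcPhi N p fhat chat := by
  funext κ
  simp only [srcPhi, Pi.smul_apply, smul_eq_mul, mul_sub, Finset.mul_sum]
  congr 1
  refine Finset.sum_congr rfl fun m _ => ?_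
  rw [piPerp_smul, Pi.smul_apply, smul_eq_mul]
  ring

/-- [folklore] `r_c` is linear in `f̂`. -/
theorem srcC_smul : srcC N p (c • fhat) = c * srcC N p fhat := by
  unfold srcC
  have h : ∀ m, dot (dbAl N p m) ((c • fhat) m) = c * dot (dbAl N p m) (fhat m) := fun m => dot_smul_pi c _ _
  simp_rw [h]
  rw [mul_neg, Finset.mul_sum]
  congr 1
  exact Finset.sum_congr rfl fun m _ => by ring

/-- [folklore] `(φ; c) = Cap⁻¹(r_φ; r_c)` is linear in the sources. -/
theorem capSol_smul : capSol N p (c • fhat) (c • chat) = c • capSol N p fhat chat := by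
  unfold capSol
  rw [srcPhi_smul, srcC_smul, ← Matrix.mulVec_smul]
  congr 1
  funext i; rcases i with κ | u <;> simp

/-- [folklore] `φ` is linear in the sources. -/
theorem phiSol_smul (κ : Fin D) : phiSol N p (c • fhat) (c • chat) κ = c * phiSol N p fhat chat κ := by
  simp only [phiSol, capSol_smul, Pi.smul_apply, smul_eq_mul]

/-- [folklore] `φ` is linear in the force source alone. -/
theorem phiSol_smul_left (κ : Fin D) : phiSol N p (c • fhat) 0 κ = c * phiSol N p fhat 0 κ := by
  have h := phiSol_smul p c fhat 0 κ
  rwa [smul_zero] at h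

/-- [folklore] `φ` is linear in the constraint source alone. -/
theorem phiSol_smul_right (κ : Fin D) : phiSol N p 0 (c • chat) κ = c * phiSol N p 0 chat κ := by
  have h := phiSol_smul p c (0 : TorusSite D N → Fin D → ℂ) chat κ
  rwa [smul_zero] at h

/-- [folklore] `c` (the gauge constant) is linear in the sources. -/
theorem cSol_smul : cSol N p (c • fhat) (c • chat) = c * cSol N p fhat chat := by
  simp only [cSol, capSol_smul, Pi.smul_apply, smul_eq_mul]

/-- [folklore] The EL feed is linear in the sources. -/
theorem gAl_smul (m : TorusSite D N) : gAl N p (c • fhat) (c • chat) m = c • gAl N p fhat chat m := by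
  funext κ
  simp only [gAl, Pi.smul_apply, smul_eq_mul, phiSol_smul]
  ring

/-- [folklore] `Asol` is linear in `(g, cc)`. -/
theorem Asol_smul (dd db g : Fin D → ℂ) (L cc : ℂ) : Asol dd db (c • g) L (c * cc) = c • Asol dd db g L cc := by
  funext κ
  simp only [Asol, Pi.smul_apply, smul_eq_mul, dot_smul_pi]
  ring

/-- [folklore] **`Â` IS LINEAR IN THE SOURCES**: `Ahat N p (c • f̂) (c • ĉ) m = c • Ahat N p f̂ ĉ m`. -/
theorem Ahat_smul (m : TorusSite D N) : Ahat N p (c • fhat) (c • chat) m = c • Ahat N p fhat chat m := by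
  unfold Ahat
  rw [gAl_smul, cSol_smul, ← mul_assoc, mul_comm (chiAl N p m) c, mul_assoc, Asol_smul]

/-- [folklore] `Â` is linear in the force source alone. -/
theorem Ahat_smul_left (m : TorusSite D N) (κ : Fin D) : Ahat N p (c • fhat) 0 m κ = c * Ahat N p fhat 0 m κ := by
  have h := Ahat_smul p c fhat 0 m
  rw [smul_zero] at h
  rw [h, Pi.smul_apply, smul_eq_mul]

/-- [folklore] `Â` is linear in the constraint source alone. -/
theorem Ahat_smul_right (m : TorusSite D N) (κ : Fin D) : Ahat N p 0 (c • chat) m κ = c * Ahat N p 0 chat m κ := by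
  have h := Ahat_smul p c (0 : TorusSite D N → Fin D → ℂ) chat m
  rw [smul_zero] at h
  rw [h, Pi.smul_apply, smul_eq_mul]

end Linear

/-! ## §3 The bridge `kFib = kFibClosed` on `BZ ∖ {0}` -/

section Bridge

variable {q : Fin (d + 1) → ℝ} (hq : q ∈ BZ (d + 1)) (hq0 : q ≠ 0)
include hq hq0

/-- [folklore] FIELD–FIELD bridge. -/
theorem kFibW_inl_inl_eq_closed (M : ℕ) (sf sm : ℝ) (κ : Fin (d + 1)) (x' : Site (d + 1)) (l : Fin (d + 1)) (y' : Site (d + 1)) :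
    kFibW N M sf sm (Sum.inl κ) x' (Sum.inl l) y' (ofRealVec q)
      = ((sf * sf : ℝ) : ℂ) * ∑ m, AliasObjects.readW N M (ofRealVec q) m κ x' * Ahat N (ofRealVec q) (fhatF N M (ofRealVec q) l y') 0 m κ := by
  have hv := fibreFun_invMulVec (N := N) q (legSrcVec N M (ofRealVec q) (legCoef M sf sm (Sum.inl l : Fib d)) (Sum.inl l) y')
  have hnoG : ∀ z : TorusSite (d + 1) N, legSrcVec N M (ofRealVec q) (legCoef M sf sm (Sum.inl l : Fib d)) (Sum.inl l) y' (Sum.inr (Sum.inl z)) = 0 :=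
    fun z => legSrcVec_inl_apply_inr M _ _ l y' _
  rw [kFibW_eq_readout, readout_inl M (ofRealVec q) _ κ x' _ _ (fun z => boxData_eq_synth_Ahat hq hq0 hv hnoG κ z),
    srcEL_legSrcVec_inl, legSrcVec_inl_Q, fieldLegSrc_eq_smul_fhatF]
  simp_rw [Ahat_smul_left, ← mul_assoc, legCoef_inl_mul_readW]
  push_cast
  rw [Finset.mul_sum]
  exact Finset.sum_congr rfl fun m _ => by ring

/-- [folklore] MULTIPLIER–FIELD bridge. -/
theorem kFibW_inr_inl_eq_closed (M : ℕ) (sf sm : ℝ) (κ : Fin (d + 1)) (x' : Site (d + 1)) (l : Fin (d + 1)) (y' : Site (d + 1)) :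
    kFibW N M sf sm (Sum.inr κ) x' (Sum.inl l) y' (ofRealVec q)
      = ((sm * sf : ℝ) : ℂ) * cphase (quo N ((M : ℤ) • x')) (ofRealVec q) * phiSol N (ofRealVec q) (fhatF N M (ofRealVec q) l y') 0 κ := by
  have hv := fibreFun_invMulVec (N := N) q (legSrcVec N M (ofRealVec q) (legCoef M sf sm (Sum.inl l : Fib d)) (Sum.inl l) y')
  have hnoG : ∀ z : TorusSite (d + 1) N, legSrcVec N M (ofRealVec q) (legCoef M sf sm (Sum.inl l : Fib d)) (Sum.inl l) y' (Sum.inr (Sum.inl z)) = 0 :=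
    fun z => legSrcVec_inl_apply_inr M _ _ l y' _
  rw [kFibW_eq_readout]
  simp only [legSet, legPt, CombesThomasFibre.legIdx, Finset.sum_singleton]
  rw [phi_eq_phiSol hq hq0 hv hnoG κ, srcEL_legSrcVec_inl, legSrcVec_inl_Q, fieldLegSrc_eq_smul_fhatF, phiSol_smul_left]
  unfold legCoef
  simp only [legScale, legW]
  push_cast
  ring

/-- [folklore] FIELD–MULTIPLIER bridge. -/
theorem kFibW_inl_inr_eq_closed (M : ℕ) (sf sm : ℝ) (κ : Fin (d + 1)) (x' : Site (d + 1)) (l : Fin (d + 1)) (y' : Site (d + 1)) :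
    kFibW N M sf sm (Sum.inl κ) x' (Sum.inr l) y' (ofRealVec q)
      = ((sf * sm : ℝ) : ℂ) * cphase (-quo N ((M : ℤ) • y')) (ofRealVec q)
          * ∑ m, AliasObjects.readW N M (ofRealVec q) m κ x' * Ahat N (ofRealVec q) 0 (eVec l) m κ := by
  have hv := fibreFun_invMulVec (N := N) q (legSrcVec N M (ofRealVec q) (legCoef M sf sm (Sum.inr l : Fib d)) (Sum.inr l) y')
  have hnoG : ∀ z : TorusSite (d + 1) N, legSrcVec N M (ofRealVec q) (legCoef M sf sm (Sum.inr l : Fib d)) (Sum.inr l) y' (Sum.inr (Sum.inl z)) = 0 :=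
    fun z => by rw [legSrcVec_inr_apply]; simp
  rw [kFibW_eq_readout, readout_inl M (ofRealVec q) _ κ x' _ _ (fun z => boxData_eq_synth_Ahat hq hq0 hv hnoG κ z),
    srcEL_legSrcVec_inr, legSrcVec_inr_Q_eq_smul_eVec]
  simp_rw [Ahat_smul_right]
  have e : ∀ m : TorusSite (d + 1) N,
      legCoef M sf sm (Sum.inl κ : Fib d) * readW N M (ofRealVec q) κ x' m
        * (legCoef M sf sm (Sum.inr l : Fib d) * cphase (-quo N ((M : ℤ) • y')) (ofRealVec q) * Ahat N (ofRealVec q) 0 (eVec l) m κ)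
      = (legCoef M sf sm (Sum.inr l : Fib d) * cphase (-quo N ((M : ℤ) • y')) (ofRealVec q))
        * (((sf : ℂ) * AliasObjects.readW N M (ofRealVec q) m κ x') * Ahat N (ofRealVec q) 0 (eVec l) m κ) := by
    intro m; rw [← legCoef_inl_mul_readW M sf sm (ofRealVec q) κ x' m]; ring
  simp_rw [e]
  unfold legCoef
  simp only [legScale, legW, Finset.mul_sum]
  push_cast
  exact Finset.sum_congr rfl fun m _ => by ring

/-- [folklore] MULTIPLIER–MULTIPLIER bridge. -/
theorem kFibW_inr_inr_eq_closed (M : ℕ) (sf sm : ℝ) (κ : Fin (d + 1)) (x' : Site (d + 1)) (l : Fin (d + 1)) (y' : Site (d + 1)) :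
    kFibW N M sf sm (Sum.inr κ) x' (Sum.inr l) y' (ofRealVec q)
      = ((sm * sm : ℝ) : ℂ) * cphase (quo N ((M : ℤ) • x') - quo N ((M : ℤ) • y')) (ofRealVec q) * phiSol N (ofRealVec q) 0 (eVec l) κ := by
  have hv := fibreFun_invMulVec (N := N) q (legSrcVec N M (ofRealVec q) (legCoef M sf sm (Sum.inr l : Fib d)) (Sum.inr l) y')
  have hnoG : ∀ z : TorusSite (d + 1) N, legSrcVec N M (ofRealVec q) (legCoef M sf sm (Sum.inr l : Fib d)) (Sum.inr l) y' (Sum.inr (Sum.inl z)) = 0 :=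
    fun z => by rw [legSrcVec_inr_apply]; simp
  rw [kFibW_eq_readout]
  simp only [legSet, legPt, CombesThomasFibre.legIdx, Finset.sum_singleton]
  rw [phi_eq_phiSol hq hq0 hv hnoG κ, srcEL_legSrcVec_inr, legSrcVec_inr_Q_eq_smul_eVec, phiSol_smul_right,
    sub_eq_add_neg, cphase_add_eq_mul]
  unfold legCoef
  simp only [legScale, legW]
  push_cast
  ring

/-- [folklore] **THE BRIDGE AT FIXED `(N, M, s_f, s_m)`**: `kFibW = kFibClosedW` at `p = ofRealVec q`, `q ∈ BZ ∖ {0}`, all leg types. -/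
theorem kFibW_eq_kFibClosedW (M : ℕ) (sf sm : ℝ) (a : Fib d) (x' : Site (d + 1)) (b : Fib d) (y' : Site (d + 1)) :
    kFibW N M sf sm a x' b y' (ofRealVec q) = kFibClosedW N M sf sm a x' b y' (ofRealVec q) := by
  cases a with
  | inl κ =>
    cases b with
    | inl l => rw [kFibW_inl_inl_eq_closed hq hq0]; rfl
    | inr l => rw [kFibW_inl_inr_eq_closed hq hq0]; rfl
  | inr κ =>
    cases b with
    | inl l => rw [kFibW_inr_inl_eq_closed hq hq0]; rfl
    | inr l => rw [kFibW_inr_inr_eq_closed hq hq0]; rfl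

end Bridge

/-- [folklore] **THE BRIDGE FOR THE STEP FIBRE FUNCTION** (row P1-L05b in T00 currency): for every `Lc ≥ 1`, `j`, units `s_f, s_m`, legs and every
`q ∈ BZ (d+1) ∖ {0}`: `kFib Lc s_f s_m j a x′ b y′ (ofRealVec q) = AliasObjects.kFibClosed Lc s_f s_m j a x′ b y′ (ofRealVec q)`. -/
theorem kFib_eq_kFibClosed {Lc : ℕ} [NeZero Lc] (sf sm : ℕ → ℝ) (j : ℕ) (a : Fib d) (x' : Site (d + 1)) (b : Fib d) (y' : Site (d + 1))
    {q : Fin (d + 1) → ℝ} (hq : q ∈ BZ (d + 1)) (hq0 : q ≠ 0) :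
    kFib Lc sf sm j a x' b y' (ofRealVec q) = kFibClosed Lc sf sm j a x' b y' (ofRealVec q) :=
  kFibW_eq_kFibClosedW (N := Lc ^ (j + 1)) hq hq0 (Lc ^ j) (sf j) (sm j) a x' b y'

end Summit.QuantumFields.BalabanUV.Beta.GAN24.KFibClosedBridge

end
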